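import Summits.MatrixMultiplication.MatrixMultiplication.Theorems.AbelianSTPPCensusThreeRoomEnergyPairs
import Summits.MatrixMultiplication.MatrixMultiplication.Theorems.AbelianSTPPCensusRoomKneser

/-!
# The three-room energy rule with Kneser-sized difference classes (E3K) (cell mm-stpp, eng-2 g7)

Refines the pair rule E3⁺⁺ (`STPPThreeRoomEnergy.three_room_energy_pairAB`, this cell) inside the same identity
`Σ_g |W ∩ (W + g)| = V²` for the block set `W = A_t − B_t + C_t` of ONE member of an `IsSTPP` family in a finite abelian group
(`|W| = V = |A_t||B_t||C_t| > |G|/2`, U14⁺ slacks `s_A, s_B, s_C`, `θ = V − Σ s`).  E3⁺⁺ credits the floor `V − s_X` to `|X_t| − 1`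
elements of the punctured difference set `(X_t − X_t) ∖ 0` and the pair floor `V − s_A − s_B` to `(|A_t| − 1)(|B_t| − 1)` elements of
ONE translate of `A_t − B_t`.  Two things are left on the table:

* the classes have their TRUE sizes: `|X_t − X_t| − 1` elements at floor `V − s_X`, and the pair floor holds on the whole difference set
  `Q := (A_t − B_t) − (A_t − B_t) = (A_t − A_t) + (B_t − B_t)` (every element is an `A`-difference plus a `B`-difference; `Q` meets
  `(C_t − C_t) ∖ 0` nowhere, by the TPP of member `t`), i.e. on `|Q| − 1 − (|A_t − A_t| − 1) − (|B_t − B_t| − 1)` further elements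
  (`three_room_energy_diffAB`: the E3⁺⁺ exchange argument with arbitrary lower bounds `n_X + 1 ≤ |X_t − X_t|`, `q ≤ |Q|`);
* KNESER bounds those sizes from the shape data: for every non-empty `S` in a finite abelian group there is a divisor `d` of `|G|`
  (the order of the stabiliser of `S − S`) with `2·d·⌈|S|/d⌉ ≤ |S − S| + d` (`two_mul_ceilDiv_le_card_sub_self`, from the tree's
  `STPPRoomKneser.kneser_budget` = `Literature.Combinatorics.Additive.add_kneser`).  Applied to `S = A_t, B_t, C_t` and `S = A_t − B_t`
  (`|A_t − B_t| = |A_t||B_t|` by the TPP).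

**E3K (`false_of_energy3k`, pair `(A,B)` of the data as given; rotate the data for the other pairs).**  If numbers `n_A, n_B, n_C, q` satisfy
`n_X + 1 + d ≤ 2d⌈x_t/d⌉` and `q + d ≤ 2d⌈a_t b_t/d⌉` for EVERY divisor `d` of `M` (so they are below the Kneser minima), then
`M·θ + (V − θ) + n_A·e_A + n_B·e_B + n_C·e_C + (q − 1 − n_A − n_B)·e_AB ≤ V²` (`e_X = (V − s_X) − θ`, `e_AB = (V − s_A − s_B) − θ`,
truncated throughout); a shape list violating this does not exist as an STPP family in any abelian group of order `M`.

Reach (seat arithmetic HOME/mm-stpp-eng-2 g7, exact integers; recorded vQ-alive lists of eng-1 j274236/j274239): E3K kills 349 of the 1 668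
recorded lists (E3⁺⁺: 208), among them EVERY recorded list at the abelian orders 483, 484, 485 — instances below: the E3⁺⁺-survivor
`(8,6,6)+(7,7,6)²+(6,6,6)+(5,5,5)` at 484 (E3⁺⁺ margin 162; E3K `88 152 > 86 436`), both lists at 485, and `(7,7,7)⁵` at 589 and 591 (E3⁺⁺'s
uniform-window ceiling was 588) — and its first recorded survivor is `(7,7,6)³+(6,6,6)+(5,5,5)` at 486 (margin `1 517`; 487: `630`).
WHAT THIS IS NOT: no `ω` statement, no census number (where vP ∧ E3⁺ ∧ E3K first goes blind is a census question for a complete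
enumerator), no existence claim; a necessary condition two orders sharper than E3⁺⁺ on the thin `T_E` frontier, silent below doubling like
every rule of this family.
-/

-- single-conjunct summit: the mandated namespace repeats `MatrixMultiplication`.
set_option linter.dupNamespace false

namespace Summit.MatrixMultiplication.MatrixMultiplication.Theorems

namespace STPPThreeRoomEnergy

open Finset Literature.Computability.AlgebraicComplexity
open scoped Pointwise

variable {G : Type*} [AddCommGroup G] [DecidableEq G] [Fintype G] {N : ℕ} {A B C : Fin N → Finset G}

/-! ## Kneser's bound for a difference set -/

omit [DecidableEq G] in
/-- **Kneser for `S − S`.**  For a non-empty finset `S` of a finite abelian group there is a divisor `d` of `|G|` (the order of the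
stabiliser of `S − S`) with `2·d·⌈|S|/d⌉ ≤ |S − S| + d`; in particular `|S − S| ≥ min_{d ∣ |G|} (2d⌈|S|/d⌉ − d)`.
(Kneser 1953 for the pair `(S, −S)`; tree `STPPRoomKneser.kneser_budget`.) [cite: Nathanson1996, Thm 4.3] -/
theorem two_mul_ceilDiv_le_card_sub_self [DecidableEq G] (S : Finset G) (hS : S.Nonempty) :
    ∃ d : ℕ, d ∣ Fintype.card G ∧ 0 < d ∧ 2 * (d * ((S.card + d - 1) / d)) ≤ (S - S).card + d := by
  obtain ⟨d, hd, hdpos, hineq⟩ :=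
    STPPRoomKneser.kneser_budget S (-S) hS hS.neg (S - S).card (by rw [← sub_eq_add_neg])
  rw [card_neg] at hineq
  refine ⟨d, hd, hdpos, ?_⟩
  have h1 := Nat.mul_div_le (S - S).card d
  omega

/-! ## E3 with exact class sizes: the pair class on the whole difference set of `A_t − B_t` -/

/-- **E3 with difference-class sizes, pair `(A,B)`.**  Hypotheses as in `three_room_energy_plus`; for any `n_A, n_B, n_C, q` with
`n_X + 1 ≤ |X_t − X_t|` (`X = A, B, C`) and `q ≤ |(A_t − B_t) − (A_t − B_t)|`:
`|G|·θ + (V − θ) + n_A·((V − s_A) − θ) + n_B·((V − s_B) − θ) + n_C·((V − s_C) − θ) + (q − 1 − n_A − n_B)·((V − s_A − s_B) − θ) ≤ V²`.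
(Floors: `V` at `0`; `V − s_X` on `(X_t − X_t) ∖ 0` — pairwise disjoint by the TPP; `V − s_A − s_B` on the rest of
`(A_t − B_t) − (A_t − B_t) = (A_t − A_t) + (B_t − B_t)`, which avoids `(C_t − C_t) ∖ 0` by the TPP; `θ` elsewhere (`2V > |G|`);
summed inside `Σ_g |W ∩ (W+g)| = V²`, then the E3⁺⁺ exchange.) [original] -/
theorem three_room_energy_diffAB (h : IsSTPP A B C) (hA : ∀ u, (A u).Nonempty) (hB : ∀ u, (B u).Nonempty)
    (hC : ∀ u, (C u).Nonempty) (t : Fin N) (sA sB sC : ℕ)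
    (hsA : Fintype.card G ≤ (A t).card * (B t).card * (C t).card +
      (∑ u ∈ univ.erase t, (B u).card * (C u).card) + sA)
    (hsB : Fintype.card G ≤ (A t).card * (B t).card * (C t).card +
      (∑ u ∈ univ.erase t, (C u).card * (A u).card) + sB)
    (hsC : Fintype.card G ≤ (A t).card * (B t).card * (C t).card +
      (∑ u ∈ univ.erase t, (A u).card * (B u).card) + sC)
    (hbig : Fintype.card G < 2 * ((A t).card * (B t).card * (C t).card))
    (nA nB nC q : ℕ) (hnA : nA + 1 ≤ (A t - A t).card) (hnB : nB + 1 ≤ (B t - B t).card)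
    (hnC : nC + 1 ≤ (C t - C t).card) (hq : q ≤ ((A t - B t) - (A t - B t)).card) :
    Fintype.card G * ((A t).card * (B t).card * (C t).card - (sA + sB + sC)) +
      ((A t).card * (B t).card * (C t).card - ((A t).card * (B t).card * (C t).card - (sA + sB + sC))) +
      nA * (((A t).card * (B t).card * (C t).card - sA) -
        ((A t).card * (B t).card * (C t).card - (sA + sB + sC))) +
      nB * (((A t).card * (B t).card * (C t).card - sB) -
        ((A t).card * (B t).card * (C t).card - (sA + sB + sC))) +
      nC * (((A t).card * (B t).card * (C t).card - sC) -
        ((A t).card * (B t).card * (C t).card - (sA + sB + sC))) +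
      (q - 1 - nA - nB) * (((A t).card * (B t).card * (C t).card - (sA + sB)) -
        ((A t).card * (B t).card * (C t).card - (sA + sB + sC))) ≤
      ((A t).card * (B t).card * (C t).card) ^ 2 := by
  set W := A t - B t + C t with hW
  set V := (A t).card * (B t).card * (C t).card with hVdef
  have hV : W.card = V := STPPIteratedRoom.card_sub_add_eq h t
  set θ := V - (sA + sB + sC) with hθ
  set eA := (V - sA) - θ with heA
  set eB := (V - sB) - θ with heB
  set eC := (V - sC) - θ with heC
  set eT := (V - (sA + sB)) - θ with heT
  set PA := (A t - A t).erase 0 with hPA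
  set PB := (B t - B t).erase 0 with hPB
  set PC := (C t - C t).erase 0 with hPC
  obtain ⟨a₀, ha₀⟩ := hA t
  obtain ⟨b₀, hb₀⟩ := hB t
  obtain ⟨c₀, hc₀⟩ := hC t
  -- the difference set `Q` of `A_t − B_t` and its new part `Q'`
  set Q := (A t - B t) - (A t - B t) with hQ
  set Q' := Q.filter (fun g => g ≠ 0 ∧ g ∉ PA ∧ g ∉ PB ∧ g ∉ PC) with hQ'
  -- floors
  have fQ : ∀ g ∈ Q, V ≤ (W.filter (· - g ∈ W)).card + (sA + sB) := by
    intro g hg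
    rw [hQ, mem_sub] at hg
    obtain ⟨x, hx, y, hy, rfl⟩ := hg
    obtain ⟨a, ha, b, hb, rfl⟩ := mem_sub.1 hx
    obtain ⟨a', ha', b', hb', rfl⟩ := mem_sub.1 hy
    have e : a - b - (a' - b') = (a - a') + (b' - b) := by abel
    have h1 := popular_A h hA t sA hsA (a - a') (sub_mem_sub ha ha')
    have h2 := popular_B h hA hB t sB hsB (b' - b) (sub_mem_sub hb' hb)
    have h3 := STPPIteratedRoom.overlap_add (A t - B t + C t) (a - a') (b' - b)
    rw [← hW, hV] at h1 h2 h3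
    rw [e]; omega
  set f : G → ℕ := fun g => θ + (if g = 0 then V - θ else 0) + (if g ∈ PA then eA else 0) +
    (if g ∈ PB then eB else 0) + (if g ∈ PC then eC else 0) + (if g ∈ Q' then eT else 0) with hf
  have key : ∀ g, f g ≤ (W.filter (· - g ∈ W)).card := by
    intro g
    have h0 := popular_all h hA hB hC t sA sB sC hsA hsB hsC hbig g
    rw [← hW, hV] at h0
    by_cases hgQ : g ∈ Q'
    · have hg' := (mem_filter.1 hgQ).2
      have hQ0 := fQ g (mem_filter.1 hgQ).1
      simp only [hf, if_neg hg'.1, if_neg hg'.2.1, if_neg hg'.2.2.1, if_neg hg'.2.2.2, if_pos hgQ, add_zero]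
      omega
    by_cases hg : g = 0
    · subst hg
      have hz := STPPIteratedRoom.overlap_zero W
      have n1 : (0 : G) ∉ PA := fun hm => (mem_erase.1 hm).1 rfl
      have n2 : (0 : G) ∉ PB := fun hm => (mem_erase.1 hm).1 rfl
      have n3 : (0 : G) ∉ PC := fun hm => (mem_erase.1 hm).1 rfl
      simp only [hf, if_true, if_neg n1, if_neg n2, if_neg n3, if_neg hgQ, add_zero]
      rw [hz, hV]; omega
    · by_cases hgA : g ∈ PA
      · have n2 : g ∉ PB := fun hm =>
          hg (eq_zero_of_mem_sub_A_of_mem_sub_B h t (hC t) (mem_erase.1 hgA).2 (mem_erase.1 hm).2)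
        have n3 : g ∉ PC := fun hm =>
          hg (eq_zero_of_mem_sub_A_of_mem_sub_C h t (hB t) (mem_erase.1 hgA).2 (mem_erase.1 hm).2)
        have h1 := popular_A h hA t sA hsA g (mem_erase.1 hgA).2
        rw [← hW, hV] at h1
        simp only [hf, if_neg hg, if_pos hgA, if_neg n2, if_neg n3, if_neg hgQ, add_zero]
        omega
      · by_cases hgB : g ∈ PB
        · have n3 : g ∉ PC := fun hm =>
            hg (eq_zero_of_mem_sub_B_of_mem_sub_C h t (hA t) (mem_erase.1 hgB).2 (mem_erase.1 hm).2)
          have h1 := popular_B h hA hB t sB hsB g (mem_erase.1 hgB).2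
          rw [← hW, hV] at h1
          simp only [hf, if_neg hg, if_neg hgA, if_pos hgB, if_neg n3, if_neg hgQ, add_zero]
          omega
        · by_cases hgC : g ∈ PC
          · have h1 := STPPIteratedRoom.room_popular h hC t sC hsC g (mem_erase.1 hgC).2
            rw [← hW, hV] at h1
            simp only [hf, if_neg hg, if_neg hgA, if_neg hgB, if_pos hgC, if_neg hgQ, add_zero]
            omega
          · simp only [hf, if_neg hg, if_neg hgA, if_neg hgB, if_neg hgC, if_neg hgQ, add_zero]
            omega
  have hsum : ∑ g, f g = Fintype.card G * θ + (V - θ) + PA.card * eA + PB.card * eB + PC.card * eC +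
      Q'.card * eT := by
    simp only [hf, sum_add_distrib, sum_const, card_univ, smul_eq_mul, sum_ite_eq', mem_univ, if_true,
      sum_ite_mem_univ]
  have hle : ∑ g, f g ≤ V ^ 2 := by
    rw [← hV, ← sum_overlap_eq_sq W]; exact sum_le_sum fun g _ => key g
  -- `Q` meets `PC` nowhere (TPP of member `t`)
  have hQPC : ∀ g ∈ Q, g ∉ PC := by
    intro g hg hgC
    rw [hQ, mem_sub] at hg
    obtain ⟨x, hx, y, hy, rfl⟩ := hg
    obtain ⟨a, ha, b, hb, rfl⟩ := mem_sub.1 hx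
    obtain ⟨a', ha', b', hb', rfl⟩ := mem_sub.1 hy
    have hne := (mem_erase.1 hgC).1
    obtain ⟨c, hc, c', hc', he⟩ := mem_sub.1 (mem_erase.1 hgC).2
    have keq : (a - a') + (b' - b) + (c' - c) = 0 := by
      have : c - c' = a - b - (a' - b') := he
      calc (a - a') + (b' - b) + (c' - c) = (a - b - (a' - b')) - (c - c') := by abel
        _ = 0 := by rw [this, sub_self]
    obtain ⟨-, -, hs, ht', -⟩ := h t t t a' ha' a ha b hb b' hb' c hc c' hc' keq
    apply hne
    rw [← hs, ht', sub_self]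
  -- counting the new part: `|Q| ≤ |Q'| + 1 + |PA| + |PB|`
  have hcount : Q.card ≤ Q'.card + 1 + PA.card + PB.card := by
    have hsplit : Q ⊆ Q' ∪ ({0} ∪ (PA ∩ Q) ∪ (PB ∩ Q)) := by
      intro g hg
      by_cases h0 : g = 0
      · subst h0; simp
      by_cases h1 : g ∈ PA
      · exact mem_union_right _ (mem_union_left _ (mem_union_right _ (mem_inter.2 ⟨h1, hg⟩)))
      by_cases h2 : g ∈ PB
      · exact mem_union_right _ (mem_union_right _ (mem_inter.2 ⟨h2, hg⟩))
      · exact mem_union_left _ (mem_filter.2 ⟨hg, h0, h1, h2, hQPC g hg⟩)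
    have := card_le_card hsplit
    have u1 := card_union_le Q' ({0} ∪ (PA ∩ Q) ∪ (PB ∩ Q))
    have u2 := card_union_le ({0} ∪ (PA ∩ Q)) (PB ∩ Q)
    have u3 := card_union_le ({0} : Finset G) (PA ∩ Q)
    have i1 := card_le_card (inter_subset_left : PA ∩ Q ⊆ PA)
    have i2 := card_le_card (inter_subset_left : PB ∩ Q ⊆ PB)
    rw [card_singleton] at u3
    omega
  -- sizes of the punctured difference sets: `|PX| = |X_t − X_t| − 1 ≥ n_X`
  have hPAc : nA ≤ PA.card := by
    have h0 : (0 : G) ∈ A t - A t := by simpa using sub_mem_sub ha₀ ha₀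
    rw [hPA, card_erase_of_mem h0]; omega
  have hPBc : nB ≤ PB.card := by
    have h0 : (0 : G) ∈ B t - B t := by simpa using sub_mem_sub hb₀ hb₀
    rw [hPB, card_erase_of_mem h0]; omega
  have hPCc : nC ≤ PC.card := by
    have h0 : (0 : G) ∈ C t - C t := by simpa using sub_mem_sub hc₀ hc₀
    rw [hPC, card_erase_of_mem h0]; omega
  -- the exchange: floors of surplus `A`-/`B`-differences dominate `eT`
  have heTA : eT ≤ eA := by rw [heT, heA]; omega
  have heTB : eT ≤ eB := by rw [heT, heB]; omega
  obtain ⟨α, hα⟩ := Nat.exists_eq_add_of_le hPAc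
  obtain ⟨β, hβ⟩ := Nat.exists_eq_add_of_le hPBc
  have hnQ : q - 1 - nA - nB ≤ α + β + Q'.card := by
    rw [hα, hβ] at hcount; omega
  have hex : nA * eA + nB * eB + (q - 1 - nA - nB) * eT ≤ PA.card * eA + PB.card * eB + Q'.card * eT := by
    rw [hα, hβ, add_mul, add_mul]
    have h1 : α * eT ≤ α * eA := Nat.mul_le_mul_left α heTA
    have h2 : β * eT ≤ β * eB := Nat.mul_le_mul_left β heTB
    have h3 : (q - 1 - nA - nB) * eT ≤ (α + β + Q'.card) * eT := Nat.mul_le_mul_right eT hnQ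
    rw [add_mul, add_mul] at h3
    omega
  have hc3 : nC * eC ≤ PC.card * eC := Nat.mul_le_mul_right eC hPCc
  calc Fintype.card G * θ + (V - θ) + nA * eA + nB * eB + nC * eC + (q - 1 - nA - nB) * eT
      ≤ Fintype.card G * θ + (V - θ) + PA.card * eA + PB.card * eB + PC.card * eC + Q'.card * eT := by
        omega
    _ = ∑ g, f g := hsum.symm
    _ ≤ V ^ 2 := hle

/-! ## Kill schema on shape data -/

/-- **Kill schema (E3K, pair `(A,B)` of the data as given).**  Shape data `a, b, c` (all positive) of an `IsSTPP` family in an abelian group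
of order `M`, a member `t` with `V = a_t b_t c_t > M/2`, the off-member sums `S_A = Σ_{u≠t} b_u c_u`, `S_B = Σ_{u≠t} c_u a_u`,
`S_C = Σ_{u≠t} a_u b_u`, and numbers `n_A, n_B, n_C, q` below the Kneser minima — `n_X + 1 + d ≤ 2d⌈x_t/d⌉` and `q + d ≤ 2d⌈a_t b_t/d⌉` for
EVERY divisor `d` of `M` (hence `n_X + 1 ≤ |X_t − X_t|` and `q ≤ |(A_t − B_t) − (A_t − B_t)|` by `two_mul_ceilDiv_le_card_sub_self`): if
`V² < M·θ + (V − θ) + n_A e_A + n_B e_B + n_C e_C + (q − 1 − n_A − n_B) e_AB` (slacks `s_X = M − (V + S_X)`, `θ = V − Σ s`,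
`e_X = (V − s_X) − θ`, `e_AB = (V − (s_A + s_B)) − θ`, all truncated), the family does not exist.  To use the pair `(B,C)` or `(C,A)`
rotate the shape data `(a,b,c) ↦ (b,c,a)` (the family rotates by `IsSTPP.rotate`). [original] -/
theorem false_of_energy3k (h : IsSTPP A B C) {a b c : Fin N → ℕ} (ha : ∀ r, (A r).card = a r)
    (hb : ∀ r, (B r).card = b r) (hc : ∀ r, (C r).card = c r) (hpos : ∀ r, 0 < a r ∧ 0 < b r ∧ 0 < c r)
    {M : ℕ} (hM : Fintype.card G = M) (t : Fin N) (SA SB SC : ℕ)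
    (hSA : SA = ∑ u ∈ univ.erase t, b u * c u) (hSB : SB = ∑ u ∈ univ.erase t, c u * a u)
    (hSC : SC = ∑ u ∈ univ.erase t, a u * b u) (nA nB nC q : ℕ)
    (hnA : ∀ d ∈ M.divisors, nA + 1 + d ≤ 2 * (d * ((a t + d - 1) / d)))
    (hnB : ∀ d ∈ M.divisors, nB + 1 + d ≤ 2 * (d * ((b t + d - 1) / d)))
    (hnC : ∀ d ∈ M.divisors, nC + 1 + d ≤ 2 * (d * ((c t + d - 1) / d)))
    (hq : ∀ d ∈ M.divisors, q + d ≤ 2 * (d * ((a t * b t + d - 1) / d)))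
    (hbig : M < 2 * (a t * b t * c t))
    (hkill : (a t * b t * c t) ^ 2 <
      M * (a t * b t * c t - ((M - (a t * b t * c t + SA)) + (M - (a t * b t * c t + SB)) +
        (M - (a t * b t * c t + SC)))) +
      (a t * b t * c t - (a t * b t * c t - ((M - (a t * b t * c t + SA)) + (M - (a t * b t * c t + SB)) +
        (M - (a t * b t * c t + SC))))) +
      nA * ((a t * b t * c t - (M - (a t * b t * c t + SA))) - (a t * b t * c t -
        ((M - (a t * b t * c t + SA)) + (M - (a t * b t * c t + SB)) + (M - (a t * b t * c t + SC))))) +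
      nB * ((a t * b t * c t - (M - (a t * b t * c t + SB))) - (a t * b t * c t -
        ((M - (a t * b t * c t + SA)) + (M - (a t * b t * c t + SB)) + (M - (a t * b t * c t + SC))))) +
      nC * ((a t * b t * c t - (M - (a t * b t * c t + SC))) - (a t * b t * c t -
        ((M - (a t * b t * c t + SA)) + (M - (a t * b t * c t + SB)) + (M - (a t * b t * c t + SC))))) +
      (q - 1 - nA - nB) * ((a t * b t * c t - ((M - (a t * b t * c t + SA)) + (M - (a t * b t * c t + SB)))) -
        (a t * b t * c t - ((M - (a t * b t * c t + SA)) + (M - (a t * b t * c t + SB)) +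
          (M - (a t * b t * c t + SC)))))) :
    False := by
  classical
  have hA : ∀ u, (A u).Nonempty := fun u => card_pos.1 (by rw [ha u]; exact (hpos u).1)
  have hB : ∀ u, (B u).Nonempty := fun u => card_pos.1 (by rw [hb u]; exact (hpos u).2.1)
  have hC : ∀ u, (C u).Nonempty := fun u => card_pos.1 (by rw [hc u]; exact (hpos u).2.2)
  have hMpos : M ≠ 0 := by rw [← hM]; exact Fintype.card_ne_zero
  -- Kneser lower bounds for the four difference sets
  have kA : nA + 1 ≤ (A t - A t).card := by
    obtain ⟨d, hd, -, hineq⟩ := two_mul_ceilDiv_le_card_sub_self (A t) (hA t)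
    have hdm : d ∈ M.divisors := Nat.mem_divisors.2 ⟨by rw [← hM]; exact hd, hMpos⟩
    have := hnA d hdm
    rw [ha t] at hineq
    omega
  have kB : nB + 1 ≤ (B t - B t).card := by
    obtain ⟨d, hd, -, hineq⟩ := two_mul_ceilDiv_le_card_sub_self (B t) (hB t)
    have hdm : d ∈ M.divisors := Nat.mem_divisors.2 ⟨by rw [← hM]; exact hd, hMpos⟩
    have := hnB d hdm
    rw [hb t] at hineq
    omega
  have kC : nC + 1 ≤ (C t - C t).card := by
    obtain ⟨d, hd, -, hineq⟩ := two_mul_ceilDiv_le_card_sub_self (C t) (hC t)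
    have hdm : d ∈ M.divisors := Nat.mem_divisors.2 ⟨by rw [← hM]; exact hd, hMpos⟩
    have := hnC d hdm
    rw [hc t] at hineq
    omega
  have kQ : q ≤ ((A t - B t) - (A t - B t)).card := by
    obtain ⟨d, hd, -, hineq⟩ := two_mul_ceilDiv_le_card_sub_self (A t - B t) ((hA t).sub (hB t))
    have hdm : d ∈ M.divisors := Nat.mem_divisors.2 ⟨by rw [← hM]; exact hd, hMpos⟩
    have := hq d hdm
    rw [STPPPackingSumset.card_sub_eq h t (hC t), ha t, hb t] at hineq
    omega
  have eA : ∑ u ∈ univ.erase t, (B u).card * (C u).card = SA := by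
    rw [hSA]; exact sum_congr rfl fun u _ => by rw [hb u, hc u]
  have eB : ∑ u ∈ univ.erase t, (C u).card * (A u).card = SB := by
    rw [hSB]; exact sum_congr rfl fun u _ => by rw [hc u, ha u]
  have eC : ∑ u ∈ univ.erase t, (A u).card * (B u).card = SC := by
    rw [hSC]; exact sum_congr rfl fun u _ => by rw [ha u, hb u]
  have := three_room_energy_diffAB h hA hB hC t (M - (a t * b t * c t + SA)) (M - (a t * b t * c t + SB))
    (M - (a t * b t * c t + SC)) (by rw [eA, ha t, hb t, hc t, hM]; omega)
    (by rw [eB, ha t, hb t, hc t, hM]; omega) (by rw [eC, ha t, hb t, hc t, hM]; omega)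
    (by rw [ha t, hb t, hc t, hM]; exact hbig) nA nB nC q kA kB kC kQ
  rw [ha t, hb t, hc t, hM] at this
  exact absurd this (not_le.2 hkill)

/-! ## Instances: the E3⁺⁺-survivors of the thin `T_E` frontier, and two more orders of the uniform `(7,7,7)⁵` window -/

/-- **Order 484, shapes `(8,6,6), (7,7,6), (7,7,6), (6,6,6), (5,5,5)`: impossible** in every abelian group of order `484 = 2²·11²` —
the first E3⁺⁺-survivor of the record (E3⁺⁺ margin `162`).  Member `1 = (7,7,6)`: `V = 294`, off-member sums `139, 151, 158`, slacks
`(51, 39, 32)`, `θ = 172`; Kneser minima over `d ∣ 484`: `|A−A|, |B−B| ≥ 11` (`d = 11`), `|C−C| ≥ 10` (`d = 2`), `|Q| ≥ 97` (`d = 1`);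
`83 248 + 122 + 10·71 + 10·83 + 9·90 + (97 − 21)·32 = 88 152 > 86 436 = 294²`. [original] -/
theorem no_866_776_776_666_555_at_484 {A B C : Fin 5 → Finset G} (h : IsSTPP A B C)
    (hA : ∀ r, (A r).card = ![8, 7, 7, 6, 5] r) (hB : ∀ r, (B r).card = ![6, 7, 7, 6, 5] r)
    (hC : ∀ r, (C r).card = ![6, 6, 6, 6, 5] r) (hM : Fintype.card G = 484) : False :=
  false_of_energy3k (a := ![8, 7, 7, 6, 5]) (b := ![6, 7, 7, 6, 5]) (c := ![6, 6, 6, 6, 5]) h hA hB hC (by decide) hM 1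
    139 151 158 (by decide) (by decide) (by decide) 10 10 9 97 (by decide) (by decide) (by decide) (by decide) (by decide)
    (by decide)

/-- **Order 485, shapes `(8,6,6), (7,7,6), (7,7,6), (6,6,6), (5,5,5)`: impossible** (`485 = 5·97`; member `1`: slacks `(52, 40, 33)`,
`θ = 169`, Kneser minima `13, 13, 11, 95`; `84 906 + 70·33 = 87 216 > 86 436`). [original] -/
theorem no_866_776_776_666_555_at_485 {A B C : Fin 5 → Finset G} (h : IsSTPP A B C)
    (hA : ∀ r, (A r).card = ![8, 7, 7, 6, 5] r) (hB : ∀ r, (B r).card = ![6, 7, 7, 6, 5] r)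
    (hC : ∀ r, (C r).card = ![6, 6, 6, 6, 5] r) (hM : Fintype.card G = 485) : False :=
  false_of_energy3k (a := ![8, 7, 7, 6, 5]) (b := ![6, 7, 7, 6, 5]) (c := ![6, 6, 6, 6, 5]) h hA hB hC (by decide) hM 1
    139 151 158 (by decide) (by decide) (by decide) 12 12 10 95 (by decide) (by decide) (by decide) (by decide) (by decide)
    (by decide)

/-- **Order 485, shapes `(7,7,6)³ + (6,6,6) + (5,5,5)`: impossible** (the other recorded vQ-alive class at 485; member `0`: off-member sums
`145, 145, 159`, slacks `(46, 46, 32)`, `θ = 170`, Kneser minima `13, 13, 11, 95`; `85 366 + 70·32 = 87 606 > 86 436`). [original] -/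
theorem no_776x3_666_555_at_485 {A B C : Fin 5 → Finset G} (h : IsSTPP A B C)
    (hA : ∀ r, (A r).card = ![7, 7, 7, 6, 5] r) (hB : ∀ r, (B r).card = ![7, 7, 7, 6, 5] r)
    (hC : ∀ r, (C r).card = ![6, 6, 6, 6, 5] r) (hM : Fintype.card G = 485) : False :=
  false_of_energy3k (a := ![7, 7, 7, 6, 5]) (b := ![7, 7, 7, 6, 5]) (c := ![6, 6, 6, 6, 5]) h hA hB hC (by decide) hM 0
    145 145 159 (by decide) (by decide) (by decide) 12 12 10 95 (by decide) (by decide) (by decide) (by decide) (by decide)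
    (by decide)

set_option maxRecDepth 4096 in
/-- **Order 589, shapes `(7,7,7)⁵`: impossible** — one order past E3⁺⁺'s uniform-window ceiling 588 (`no_777x5_at_588`): `589 = 19·31`,
slacks `50, 50, 50`, `θ = 193`, Kneser minima `13, 13, 13, 93` (`d = 31` for `|Q|`); `113 677 + 150 + 3·12·100 + 68·50 = 120 827 > 117 649`.
[original] -/
theorem no_777x5_at_589 {A B C : Fin 5 → Finset G} (h : IsSTPP A B C)
    (hA : ∀ r, (A r).card = 7) (hB : ∀ r, (B r).card = 7) (hC : ∀ r, (C r).card = 7)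
    (hM : Fintype.card G = 589) : False :=
  false_of_energy3k (a := fun _ => 7) (b := fun _ => 7) (c := fun _ => 7) h hA hB hC (by decide) hM 0 196 196 196
    (by decide) (by decide) (by decide) 12 12 12 93 (by decide) (by decide) (by decide) (by decide) (by decide) (by decide)

set_option maxRecDepth 4096 in
/-- **Order 591, shapes `(7,7,7)⁵`: impossible** (`591 = 3·197`, slacks `52, 52, 52`, `θ = 187`, Kneser minima `13, 13, 13, 97`;
`110 517 + 156 + 36·104 + 72·52 = 118 161 > 117 649`).  At 590 and from 592 on the list passes E3K (seat table). [original] -/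
theorem no_777x5_at_591 {A B C : Fin 5 → Finset G} (h : IsSTPP A B C)
    (hA : ∀ r, (A r).card = 7) (hB : ∀ r, (B r).card = 7) (hC : ∀ r, (C r).card = 7)
    (hM : Fintype.card G = 591) : False :=
  false_of_energy3k (a := fun _ => 7) (b := fun _ => 7) (c := fun _ => 7) h hA hB hC (by decide) hM 0 196 196 196
    (by decide) (by decide) (by decide) 12 12 12 97 (by decide) (by decide) (by decide) (by decide) (by decide) (by decide)

/-! ## The letter variant at 473 that E3⁺⁺ misses (appended 2026-08-27, eng-2 g7; kit j284170)

The E3⁺⁺ probe (planner engine A″+G with the pair rule as node test, eng-2 g7 kit j284170, one enumeration lineage) finds order 472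
EXCLUDED and, at 473, exactly ONE alive class: `(8,6,6)⁴ + (3,4,4)` — the letter variant of REF [255]'s list in which the small member's
`3` sits in the heavy members' `8`-letter (E3⁺⁺ misses it by `57`; the variant `(6,6,8)⁴ + (3,4,4)` of `no_6668x4_344_at_473` dies under
E3⁺⁺).  E3K kills it: member `0 = (8,6,6)`, off-member sums `S_A = 124`, `S_B = 156`, `S_C = 156`, slacks `(61, 29, 29)`, `θ = 169`,
Kneser minima over `d ∣ 473 = 11·43`: `|X−X| ≥ 11` for all three letters (`n_X = 10`), `|Q_AB| ≥ 95`; pair `(A,B)`: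
`82 436 + (95 − 21)·29 = 84 582 > 82 944 = 288²`. -/

/-- **Order 473, shapes `(8,6,6)⁴ + (3,4,4)`: impossible** in every abelian group of order `473` — the only vP ∧ E3⁺ ∧ E3⁺⁺-alive class
at 473 (probe j284170) dies under E3K (`84 582 > 82 944`). [original] -/
theorem no_8666x4_344_at_473 {A B C : Fin 5 → Finset G} (h : IsSTPP A B C)
    (hA : ∀ r, (A r).card = ![8, 8, 8, 8, 3] r) (hB : ∀ r, (B r).card = ![6, 6, 6, 6, 4] r)
    (hC : ∀ r, (C r).card = ![6, 6, 6, 6, 4] r) (hM : Fintype.card G = 473) : False :=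
  false_of_energy3k (a := ![8, 8, 8, 8, 3]) (b := ![6, 6, 6, 6, 4]) (c := ![6, 6, 6, 6, 4]) h hA hB hC (by decide) hM 0
    124 156 156 (by decide) (by decide) (by decide) 10 10 10 95 (by decide) (by decide) (by decide) (by decide) (by decide)
    (by decide)


end STPPThreeRoomEnergy

end Summit.MatrixMultiplication.MatrixMultiplication.Theorems
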